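import Summits.AtomisticToContinuum.Crystallization.Theorems.PricedLinkCensusLocalToGlobalFccLattice
import Summits.AtomisticToContinuum.Crystallization.Theorems.PricedLinkCensusLocalToGlobalThomsonDefs

/-!
# Geometry of an fcc patch: nearest-neighbour distance, the cell, its lattice translates

Route `PricedLinkCensus`, crux `LocalToGlobal` (stmt-AtomisticToContinuum-14232), line
`flux-cell-joint-census`, support for the registered stub `stub_fccMirrorExact : NewtonShell8 → FccMirrorExact`
(`Theorems/PricedLinkCensusLocalToGlobalDefs`).  Under the hypotheses of `FccMirrorExact` — an injective
configuration `y` that coincides with `yᵢ + fcc(a)` within `3ρ₀a` of the site `i`, `ρ₀ ≥ 1`, `a > 0`: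

* `nearestDist y i = a` (`nearestDist_eq_of_fcc`);
* the truncated strict Voronoi cell `cell ρ₀ y i` IS the open rhombic dodecahedron `yᵢ +ᵥ fccVoronoi a`
  (`cell_eq_vadd_fccVoronoi`: the truncation at `ρ₀ a ≥ a` and the far, possibly non-lattice sites do not cut
  it; the near sites are lattice points and `PricedLinkCensusLocalToGlobalFccLattice` applies) — registered
  sub-goal `fccMirror_geometry`;
* hence the lattice translates `p +ᵥ cell ρ₀ y i`, `p ∈ fcc(a)`, are open, pairwise disjoint and contain the
  smearing balls `B(yᵢ + p, a/2)`: the replicated cells fed to `stub_confinedThomson` in the lower bound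
  `S₆(a) ≤ fluxCell`;
* TRANSLATION COVARIANCE of the flux-tube objects at zero transfer (`G = 0`): `smearedPair`, `admissible`,
  `tubeEnergy` and `fluxCell` are invariant under translating cell, centre and field by `t ∈ ℝ³` (Lebesgue
  measure on `ℝ⁸` is translation invariant; `emb` is additive; tests translate to tests), so every replicated
  cell has the flux cell of the original one (`fluxCell_translate`).

References: J. H. Conway, N. J. A. Sloane, *Sphere packings, lattices and groups* (1999), Ch. 21; folklore.
-/

noncomputable section

open scoped BigOperators RealInnerProductSpace Pointwise
open MeasureTheory Metric Set Filter Function Literature.Geometry.DiscreteGeometry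

namespace Summit.AtomisticToContinuum.Crystallization.Theorems.PricedLinkCensusLocalToGlobal

/-! ### The hypotheses of `FccMirrorExact`: nearest-neighbour distance and the cell -/

section Patch

variable {N : ℕ} {a ρ₀ : ℝ} {y : Fin N → E3} {i : Fin N}

/-- A specific nearest neighbour: `(a/√2)(1,1,0) ∈ fcc(a)` has norm `a`. [folklore] -/
theorem exists_mem_fccSet_norm_eq (ha : 0 < a) : ∃ v ∈ fccSet a, ‖v‖ = a :=
  ⟨(a / Real.sqrt 2) • intVec ![1, 1, 0], smul_intVec_mem_fccSet a (by decide),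
    norm_smul_intVec_of_sum_sq ha (by simp [Fin.sum_univ_three]; norm_num)⟩

/-- **`nnᵢ = a` on an fcc patch.** [folklore] -/
theorem nearestDist_eq_of_fcc (ha : 0 < a) (hρ₀ : 1 ≤ ρ₀) (hy : Injective y)
    (h1 : ∀ j, dist (y j) (y i) ≤ 3 * ρ₀ * a → y j - y i ∈ fccSet a)
    (h2 : ∀ p ∈ fccSet a, ‖p‖ ≤ 3 * ρ₀ * a → ∃ j, y j = y i + p) : nearestDist y i = a := by
  obtain ⟨v, hv, hva⟩ := exists_mem_fccSet_norm_eq ha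
  obtain ⟨j, hj⟩ := h2 v hv (by rw [hva]; nlinarith)
  have hv0 : v ≠ 0 := fun h => by rw [h, norm_zero] at hva; exact ha.ne hva
  have hji : j ≠ i := fun h => hv0 (by rw [h] at hj; exact (add_eq_left.1 hj.symm))
  refine le_antisymm ?_ (le_nearestDist ⟨j, hji⟩ fun k hk => ?_)
  · calc nearestDist y i ≤ dist (y i) (y j) := nearestDist_le_dist y hji
      _ = a := by rw [hj, dist_eq_norm, sub_add_cancel_left, norm_neg, hva]
  · by_cases hk3 : dist (y k) (y i) ≤ 3 * ρ₀ * a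
    · rw [dist_comm]
      exact le_dist_of_sub_mem_fccSet (h1 k hk3) (fun e => hk (hy e))
    · rw [dist_comm]; push Not at hk3; nlinarith

/-- **The truncated strict Voronoi cell of an fcc patch is the open rhombic dodecahedron**:
`cell ρ₀ y i = yᵢ +ᵥ fccVoronoi a`. [folklore] -/
theorem cell_eq_vadd_fccVoronoi (ha : 0 < a) (hρ₀ : 1 ≤ ρ₀) (hy : Injective y)
    (h1 : ∀ j, dist (y j) (y i) ≤ 3 * ρ₀ * a → y j - y i ∈ fccSet a)
    (h2 : ∀ p ∈ fccSet a, ‖p‖ ≤ 3 * ρ₀ * a → ∃ j, y j = y i + p) :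
    cell ρ₀ y i = y i +ᵥ fccVoronoi a := by
  have hnn := nearestDist_eq_of_fcc ha hρ₀ hy h1 h2
  have hρa : a ≤ ρ₀ * a := by nlinarith
  ext z
  rw [Set.mem_vadd_set_iff_neg_vadd_mem, vadd_eq_add, neg_add_eq_sub]
  constructor
  · rintro ⟨hzt, hzv⟩
    rw [hnn, dist_eq_norm] at hzt
    intro w hw hw0
    by_cases hw3 : ‖w‖ ≤ 3 * ρ₀ * a
    · obtain ⟨j, hj⟩ := h2 w hw hw3
      have hji : j ≠ i := fun h => hw0 (by rw [h] at hj; exact (add_eq_left.1 hj.symm))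
      have := hzv j hji
      rwa [hj, dist_eq_norm, dist_eq_norm, ← sub_sub] at this
    · push Not at hw3
      have htri : ‖w‖ ≤ ‖z - y i - w‖ + ‖z - y i‖ := by
        have := norm_sub_le (z - y i) (z - y i - w)
        rw [show z - y i - (z - y i - w) = w by abel] at this
        linarith [norm_sub_rev (z - y i) (z - y i - w)]
      nlinarith
  · intro hz
    have hza : ‖z - y i‖ < a := norm_lt_of_mem_fccVoronoi ha hz
    refine ⟨?_, fun j hji => ?_⟩
    · rw [hnn, dist_eq_norm]; linarith
    · rw [dist_eq_norm, dist_eq_norm]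
      by_cases hj3 : dist (y j) (y i) ≤ 3 * ρ₀ * a
      · have hw0 : y j - y i ≠ 0 := fun e => hji (hy (sub_eq_zero.1 e))
        have := hz (y j - y i) (h1 j hj3) hw0
        rwa [show z - y i - (y j - y i) = z - y j by abel] at this
      · push Not at hj3
        rw [dist_eq_norm] at hj3
        have htri : ‖y j - y i‖ ≤ ‖z - y j‖ + ‖z - y i‖ := by
          have := norm_sub_le (z - y i) (z - y j)
          rw [show z - y i - (z - y j) = y j - y i by abel] at this
          linarith [norm_sub_rev (z - y i) (z - y j)]
        nlinarith

/-- The lattice translates `p +ᵥ cell ρ₀ y i`, `p ∈ fcc(a)`, of the cell are pairwise disjoint. [folklore] -/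
theorem disjoint_vadd_cell (ha : 0 < a) (hρ₀ : 1 ≤ ρ₀) (hy : Injective y)
    (h1 : ∀ j, dist (y j) (y i) ≤ 3 * ρ₀ * a → y j - y i ∈ fccSet a)
    (h2 : ∀ p ∈ fccSet a, ‖p‖ ≤ 3 * ρ₀ * a → ∃ j, y j = y i + p)
    {p q : E3} (hp : p ∈ fccSet a) (hq : q ∈ fccSet a) (hpq : p ≠ q) :
    Disjoint (p +ᵥ cell ρ₀ y i) (q +ᵥ cell ρ₀ y i) := by
  rw [cell_eq_vadd_fccVoronoi ha hρ₀ hy h1 h2, vadd_vadd, vadd_vadd]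
  refine disjoint_vadd_fccVoronoi ?_ (fun h => hpq (add_right_cancel h))
  have e : q +ᵥ y i - (p +ᵥ y i) = q - p := by rw [vadd_eq_add, vadd_eq_add]; abel
  simpa [e] using sub_mem_fccSet hq hp

/-- The translates of the cell are open. [folklore] -/
theorem isOpen_vadd_cell (ρ₀ : ℝ) (y : Fin N → E3) (i : Fin N) (p : E3) : IsOpen (p +ᵥ cell ρ₀ y i) :=
  (isOpen_cell ρ₀ y i).vadd p

/-- The translates of the cell contain the translated smearing balls `B(yᵢ + p, a/2)`. [folklore] -/
theorem ball_subset_vadd_cell (ha : 0 < a) (hρ₀ : 1 ≤ ρ₀) (hy : Injective y)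
    (h1 : ∀ j, dist (y j) (y i) ≤ 3 * ρ₀ * a → y j - y i ∈ fccSet a)
    (h2 : ∀ p ∈ fccSet a, ‖p‖ ≤ 3 * ρ₀ * a → ∃ j, y j = y i + p) (p : E3) :
    ball (y i + p) (a / 2) ⊆ p +ᵥ cell ρ₀ y i := by
  have h := ball_subset_cell hρ₀ y i
  rw [nearestDist_eq_of_fcc ha hρ₀ hy h1 h2] at h
  rw [show y i + p = p +ᵥ y i by rw [vadd_eq_add, add_comm], ← Metric.vadd_ball]
  exact Set.vadd_set_mono h

/-- **Registered sub-goal `fccMirror_geometry`** (line `flux-cell-joint-census`, support of `stub_fccMirrorExact`):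
on an fcc patch the nearest-neighbour distance is `a` and the truncated strict Voronoi cell is the open rhombic
dodecahedron `yᵢ +ᵥ fccVoronoi a`. [folklore] -/
theorem fccMirror_geometry : ∀ (a ρ₀ : ℝ), 0 < a → 1 ≤ ρ₀ → ∀ (N : ℕ) (y : Fin N → E3) (i : Fin N),
    Function.Injective y → (∀ j, dist (y j) (y i) ≤ 3 * ρ₀ * a → y j - y i ∈ fccSet a) →
    (∀ p ∈ fccSet a, ‖p‖ ≤ 3 * ρ₀ * a → ∃ j, y j = y i + p) →
    nearestDist y i = a ∧ cell ρ₀ y i = y i +ᵥ fccVoronoi a :=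
  fun _ _ ha hρ₀ _ _ _ hy h1 h2 => ⟨nearestDist_eq_of_fcc ha hρ₀ hy h1 h2, cell_eq_vadd_fccVoronoi ha hρ₀ hy h1 h2⟩

end Patch

/-! ### Translation covariance of the flux-tube objects -/

/-- `emb` is additive. [folklore] -/
theorem emb_add (a b : E3) : emb (a + b) = emb a + emb b := map_add embL a b

/-- Ball integrals are translation covariant: `∫_{B(c+e,r)} f = ∫_{B(c,r)} f(· + e)`. [folklore] -/
theorem setIntegral_ball_add_center (f : E8 → ℝ) (c e : E8) (r : ℝ) :
    ∫ z in ball (c + e) r, f z = ∫ z in ball c r, f (z + e) := by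
  rw [← integral_indicator measurableSet_ball, ← integral_indicator measurableSet_ball,
    ← integral_add_right_eq_self (fun z => (ball (c + e) r).indicator f z) e]
  refine integral_congr_ae (Eventually.of_forall fun z => ?_)
  have hiff : z + e ∈ ball (c + e) r ↔ z ∈ ball c r := by rw [mem_ball, mem_ball, dist_add_right]
  simp only
  by_cases hz : z ∈ ball c r
  · rw [indicator_of_mem hz, indicator_of_mem (hiff.2 hz)]
  · rw [indicator_of_notMem hz, indicator_of_notMem (fun h => hz (hiff.1 h))]

/-- Ball averages are translation covariant. [folklore] -/
theorem setAverage_ball_add_center (f : E8 → ℝ) (c e : E8) (r : ℝ) :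
    ⨍ z in ball (c + e) r, f z = ⨍ z in ball c r, f (z + e) := by
  rw [setAverage_eq, setAverage_eq, setIntegral_ball_add_center,
    Measure.addHaar_real_ball_center volume (c + e) r, Measure.addHaar_real_ball_center volume c r]

/-- **The smeared pair kernel is translation invariant.** [folklore] -/
theorem smearedPair_add_right (x x' t : E3) (ε δ : ℝ) :
    smearedPair (x + t) (x' + t) ε δ = smearedPair x x' ε δ := by
  unfold smearedPair
  rw [emb_add, emb_add x' t, setAverage_ball_add_center]
  refine setAverage_congr_fun measurableSet_ball (Eventually.of_forall fun z _ => ?_)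
  rw [setAverage_ball_add_center]
  refine setAverage_congr_fun measurableSet_ball (Eventually.of_forall fun w _ => ?_)
  rw [show z + emb t - (w + emb t) = z - w by abel]

/-- Tubes over open cells are measurable. [folklore] -/
theorem measurableSet_tube' {Ω : Set E3} (hΩ : IsOpen Ω) : MeasurableSet (tube Ω) :=
  (hΩ.preimage (projL : E8 →L[ℝ] E3).continuous).measurableSet

/-- Membership in a translated tube: `z ∈ tube (t +ᵥ Ω) ↔ z - emb t ∈ tube Ω`. [folklore] -/
theorem mem_tube_vadd {Ω : Set E3} {t : E3} {z : E8} : z ∈ tube (t +ᵥ Ω) ↔ z - emb t ∈ tube Ω := by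
  show proj z ∈ t +ᵥ Ω ↔ proj (z - emb t) ∈ Ω
  rw [Set.mem_vadd_set_iff_neg_vadd_mem, vadd_eq_add, neg_add_eq_sub, proj_sub_emb]

/-- Integrals over translated tubes: `∫_{tube (t +ᵥ Ω)} G(· - emb t) = ∫_{tube Ω} G`. [folklore] -/
theorem setIntegral_tube_vadd {Ω : Set E3} (hΩ : IsOpen Ω) (G : E8 → ℝ) (t : E3) :
    ∫ z in tube (t +ᵥ Ω), G (z - emb t) = ∫ w in tube Ω, G w := by
  rw [← integral_indicator (measurableSet_tube' (hΩ.vadd t)), ← integral_indicator (measurableSet_tube' hΩ),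
    ← integral_add_right_eq_self (fun z => (tube (t +ᵥ Ω)).indicator (fun z => G (z - emb t)) z) (emb t)]
  refine integral_congr_ae (Eventually.of_forall fun w => ?_)
  have hiff : w + emb t ∈ tube (t +ᵥ Ω) ↔ w ∈ tube Ω := by rw [mem_tube_vadd, add_sub_cancel_right]
  simp only
  by_cases hw : w ∈ tube Ω
  · rw [indicator_of_mem hw, indicator_of_mem (hiff.2 hw), add_sub_cancel_right]
  · rw [indicator_of_notMem hw, indicator_of_notMem (fun h => hw (hiff.1 h))]

/-- Translates of test functions are test functions. [folklore] -/
theorem isTest_comp_add {φ : E8 → ℝ} (hφ : IsTest φ) (e : E8) : IsTest fun z => φ (z + e) :=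
  ⟨hφ.1.comp (contDiff_id.add contDiff_const), hφ.2.comp_homeomorph (Homeomorph.addRight e)⟩

/-- The gradient of a translate is the translated gradient. [folklore] -/
theorem gradient_comp_add (φ : E8 → ℝ) (e z : E8) : gradient (fun w => φ (w + e)) z = gradient φ (z + e) := by
  simp only [gradient]
  rw [fderiv_comp_add_right e]

/-- **Admissible confined fluxes are translation covariant** (pure confinement, `G = 0`): translating the
cell, the centre and the field by `t` preserves admissibility. [folklore] -/
theorem admissible_translate {Ω : Set E3} {x : E3} {ε : ℝ} {F : E8 → E8} (hΩ : IsOpen Ω)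
    (hF : F ∈ admissible Ω x ε (fun _ => 0)) (t : E3) :
    (fun z => F (z - emb t)) ∈ admissible (t +ᵥ Ω) (x + t) ε (fun _ => 0) := by
  obtain ⟨hmem, hvan, hweak⟩ := hF
  refine ⟨hmem.comp_measurePreserving (measurePreserving_sub_right volume (emb t)), fun z hz => ?_, fun φ hφ => ?_⟩
  · exact hvan _ (fun h => hz (mem_tube_vadd.2 h))
  · have hψ := isTest_comp_add hφ (emb t)
    have h1 : ∫ z in tube (t +ᵥ Ω), ⟪F (z - emb t) - 0, gradient φ z⟫ =
        ∫ z in tube (t +ᵥ Ω), (fun w => ⟪F w - 0, gradient (fun w => φ (w + emb t)) w⟫) (z - emb t) := by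
      refine integral_congr_ae (Eventually.of_forall fun z => ?_)
      simp only
      rw [gradient_comp_add, sub_add_cancel]
    rw [h1]
    refine (setIntegral_tube_vadd hΩ (fun w => ⟪F w - 0, gradient (fun w => φ (w + emb t)) w⟫) t).trans ?_
    rw [hweak _ hψ, emb_add, setAverage_ball_add_center]

/-- Translating there and back. [folklore] -/
theorem translate_translate (F : E8 → E8) (t : E3) :
    (fun z => (fun w => F (w - emb t)) (z - emb (-t))) = F := by
  funext z
  simp only
  rw [show emb (-t) = -emb t from map_neg embL t, sub_neg_eq_add, add_sub_cancel_right]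

/-- **The confined field energy is translation invariant** (`G = 0`). [folklore] -/
theorem tubeEnergy_translate {Ω : Set E3} (hΩ : IsOpen Ω) (x t : E3) (ε : ℝ) :
    tubeEnergy (t +ᵥ Ω) (x + t) ε (fun _ => 0) = tubeEnergy Ω x ε (fun _ => 0) := by
  unfold tubeEnergy
  congr 1
  ext r
  simp only [Set.mem_image]
  constructor
  · rintro ⟨F, hF, rfl⟩
    refine ⟨fun z => F (z - emb (-t)), ?_, ?_⟩
    · have h := admissible_translate (hΩ.vadd t) hF (-t)
      rwa [neg_vadd_vadd, add_neg_cancel_right] at h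
    · exact integral_sub_right_eq_self (fun z => ‖F z‖ ^ 2) (emb (-t))
  · rintro ⟨F, hF, rfl⟩
    refine ⟨fun z => F (z - emb t), admissible_translate hΩ hF t, ?_⟩
    exact integral_sub_right_eq_self (fun z => ‖F z‖ ^ 2) (emb t)

/-- **The flux-cell functional is translation invariant** (`G = 0`):
`fluxCell (t +ᵥ Ω) (x + t) ε 0 = fluxCell Ω x ε 0`. [folklore] -/
theorem fluxCell_translate {Ω : Set E3} (hΩ : IsOpen Ω) (x t : E3) (ε : ℝ) :
    fluxCell (t +ᵥ Ω) (x + t) ε (fun _ => 0) = fluxCell Ω x ε (fun _ => 0) := by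
  rw [fluxCell, fluxCell, tubeEnergy_translate hΩ, smearedPair_add_right]

end Summit.AtomisticToContinuum.Crystallization.Theorems.PricedLinkCensusLocalToGlobal

end
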